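/-
Copyright: rh-split cell (screw, width prover seat l1-w3) gen 0, 2026-08-27.  Splitting search over
kernel-typed RH-equivalences.  A splitting `A ∧ B ⟹ RH` is CONDITIONAL bookkeeping unless `A` and `B` are
both proved; nothing here bears on the truth of RH.
-/
import Summits.RiemannHypothesis.RiemannHypothesis.Theses.ScrewDustWall
import HarnessLib

/-!
# Route X-11 `ScrewDustWall` («DUST WALL») — item `Assembly` PROVED (pure logic), the route decl by name

`Assembly : PointComponentInvisible → DustDoesNotSeparate → DustWall → Ceil → RH`.  If RH failed, the
aliased pole field at step `1` would contain a pole `p` (`aliasedPoleSet_nonempty_of_not_rh`).  Under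
`DustWall` (the closure `T` of the pole field meets `𝔻` in a totally disconnected set) the wall component
of `p` is `{p}` and `T` contains no disc, so `p` is adherent to `𝔻 ∖ T`; under `DustDoesNotSeparate`
the set `𝔻 ∖ T` is preconnected, hence lies in the component `Ω₀` of the origin
(`zero_mem_ball_diff_closure`).  `PointComponentInvisible`, fed with Suzuki's data
(`coeff`, `mult 1`, `latticeGF 1`, `r₀ = e^{-1/2}`; tree dictionary `summable_norm_coeff`, `re_coeff_neg`,
`mult_ne_zero`, `differentiableOn_latticeGF` — this is where `Ceil = CEIL(1)` enters —,
`exp_neg_half_le_norm_of_mem`, `latticeGF_eq_borel`), says exactly that such a `p` is NOT adherent to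
`Ω₀`: contradiction.

This closes the bookkeeping item only: the splitting X-11 stays CONDITIONAL on the open conjectures
`DustWall` (TD(1)) and `Ceil` (CEIL(1)).  RH is not proved by this; nothing here bears on the truth of RH.
No `sorry`, no new axioms, no instances, no notation.
-/

set_option linter.dupNamespace false

namespace Summit.RiemannHypothesis.RiemannHypothesis.Theorems.Splittings.ScrewDust

open Set Metric
open Summit.RiemannHypothesis.RiemannHypothesis.Theorems.Splittings.ScrewBorel
open Summit.RiemannHypothesis.RiemannHypothesis.Theorems.Splittings.ScrewLatticeContinuation

/-- A totally disconnected subset of `ℂ` contains no open disc: every point of the open unit disc is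
adherent to `𝔻 ∖ T` once `T ∩ 𝔻` is totally disconnected. -/
theorem mem_closure_ball_diff_of_isTotallyDisconnected {T : Set ℂ}
    (hTd : IsTotallyDisconnected (T ∩ ball (0 : ℂ) 1)) {p : ℂ} (hp : p ∈ ball (0 : ℂ) 1) :
    p ∈ closure (ball (0 : ℂ) 1 \ T) := by
  rw [Metric.mem_closure_iff]
  intro ε hε
  by_contra hno
  push Not at hno
  -- a small disc around `p` inside `𝔻`
  have hp1 : ‖p‖ < 1 := mem_ball_zero_iff.1 hp
  set δ : ℝ := min ε (1 - ‖p‖) with hδ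
  have hδpos : 0 < δ := lt_min hε (by linarith)
  have hδε : δ ≤ ε := min_le_left _ _
  have hδ1 : δ ≤ 1 - ‖p‖ := min_le_right _ _
  have hballD : ball p δ ⊆ ball (0 : ℂ) 1 := by
    intro z hz
    rw [mem_ball_zero_iff]
    have hz' : dist z p < δ := mem_ball.1 hz
    rw [dist_eq_norm] at hz'
    calc ‖z‖ = ‖(z - p) + p‖ := by ring_nf
      _ ≤ ‖z - p‖ + ‖p‖ := norm_add_le _ _
      _ < δ + ‖p‖ := by linarith
      _ ≤ 1 := by linarith
  -- the disc misses `𝔻 ∖ T`, hence lies in `T ∩ 𝔻`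
  have hballT : ball p δ ⊆ T ∩ ball (0 : ℂ) 1 := by
    intro z hz
    refine ⟨?_, hballD hz⟩
    by_contra hzT
    have h1 := hno z ⟨hballD hz, hzT⟩
    have h2 : dist p z < δ := by rw [dist_comm]; exact mem_ball.1 hz
    linarith
  -- a disc is preconnected and has two points: contradiction with total disconnectedness
  have hsub : (ball p δ).Subsingleton := hTd _ hballT (convex_ball p δ).isPreconnected
  have hq : p + (δ / 2 : ℝ) ∈ ball p δ := by
    rw [mem_ball, dist_eq_norm, add_sub_cancel_left, Complex.norm_real, Real.norm_eq_abs,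
      abs_of_pos (by linarith)]
    linarith
  have hpp : p ∈ ball p δ := mem_ball_self hδpos
  have := hsub hq hpp
  have h0 : ((δ / 2 : ℝ) : ℂ) = 0 := by
    have := congrArg (· - p) this
    simpa using this
  have : (δ / 2 : ℝ) = 0 := by exact_mod_cast h0
  linarith

/-- In a totally disconnected trace `T ∩ 𝔻` every point is a point-component. -/
theorem connectedComponentIn_subset_singleton_of_isTotallyDisconnected {T : Set ℂ}
    (hTd : IsTotallyDisconnected (T ∩ ball (0 : ℂ) 1)) (p : ℂ) :
    connectedComponentIn (T ∩ ball (0 : ℂ) 1) p ⊆ {p} := by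
  by_cases hp : p ∈ T ∩ ball (0 : ℂ) 1
  · have hsub : (connectedComponentIn (T ∩ ball (0 : ℂ) 1) p).Subsingleton :=
      hTd _ (connectedComponentIn_subset _ _) isPreconnected_connectedComponentIn
    exact (hsub.eq_singleton_of_mem (mem_connectedComponentIn hp)).subset
  · rw [connectedComponentIn_eq_empty hp]
    exact empty_subset _

/-- **Item `Assembly` of route `ScrewDustWall` (X-11) — PROVED** (the route decl by name; pure logic over
the tree dictionary `aliasedPoleSet_nonempty_of_not_rh`, `zero_mem_ball_diff_closure`,
`summable_norm_coeff`, `re_coeff_neg`, `mult_ne_zero`, `differentiableOn_latticeGF`,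
`exp_neg_half_le_norm_of_mem`, `latticeGF_eq_borel`). -/
theorem assembly_proof :
    Summit.RiemannHypothesis.RiemannHypothesis.Theses.ScrewDustWall.Assembly := by
  intro h₁ h₂ h₃ h₄
  show RiemannHypothesis
  by_contra hRH
  obtain ⟨p, hp⟩ := aliasedPoleSet_nonempty_of_not_rh one_pos hRH
  -- the wall and the origin's component
  set T : Set ℂ := closure (aliasedPoleSet 1) with hT
  have hTd : IsTotallyDisconnected (T ∩ ball (0 : ℂ) 1) := h₃
  have hp1 : p ∈ ball (0 : ℂ) 1 := mem_ball_zero_iff.2 hp.1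
  -- `p` is a point-component of the wall
  have hcomp : connectedComponentIn (T ∩ ball (0 : ℂ) 1) p ⊆ {p} :=
    connectedComponentIn_subset_singleton_of_isTotallyDisconnected hTd p
  -- `𝔻 ∖ T` is preconnected, so it is contained in the component of `0`
  have hconn : IsPreconnected (ball (0 : ℂ) 1 \ T) := h₂ T isClosed_closure hTd
  have hΩ : ball (0 : ℂ) 1 \ T ⊆ connectedComponentIn (ball (0 : ℂ) 1 \ T) 0 :=
    hconn.subset_connectedComponentIn (zero_mem_ball_diff_closure zero_le_one) Subset.rfl
  -- `p` is adherent to `𝔻 ∖ T`, hence to the component of `0`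
  have hadh : p ∈ closure (connectedComponentIn (ball (0 : ℂ) 1 \ T) 0) :=
    closure_mono hΩ (mem_closure_ball_diff_of_isTotallyDisconnected hTd hp1)
  -- the kernel theorem forbids it
  exact h₁ coeff (mult 1) summable_norm_coeff re_coeff_neg (mult_ne_zero 1) (latticeGF 1)
    (differentiableOn_latticeGF h₄) (Real.exp (-(1 / 2))) (Real.exp_pos _)
    (fun q hq ↦ exp_neg_half_le_norm_of_mem zero_le_one hq)
    (fun z hz ↦ latticeGF_eq_borel one_pos (mem_ball_zero_iff.1 hz)) p hp hcomp hadh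

end Summit.RiemannHypothesis.RiemannHypothesis.Theorems.Splittings.ScrewDust
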